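import Summits.BirchSwinnertonDyer.Rank1Residual.Additive.X3BranchDegenerateEndStateLayerClassesT
import Summits.BirchSwinnertonDyer.Rank1Residual.Additive.X3DegenerateDisplayKitLayerArith
import Summits.BirchSwinnertonDyer.Rank1Residual.Additive.X3BranchKummerLayerTwistedArith
import HarnessLib

/-!
# X3, the DEGENERATE rows at `p = 3`, rank `0`, OFF the sub-locus: the DISPLAY KIT with BOTH sides over
# the first layer `ℚ(ζ₉)⁺` in INTEGER-TABLE form — the `needs_T_layer1` rows (cell `bsd-eis`, seat
# `bsd-eis-x3` gen 8; sequel of `X3DegenerateDisplayKitLayerArith.lean` (U-side tables, gen 7) with the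
# T-side tables of `X3BranchLayerTClassArith.lean` and the end state
# `ClassX3Gord.bsdp_three_rankZero_degenerate_of_facts_of_torsionFact_of_layerClassesT`; route K1
# `AdditiveBranchIMC`, crux `GordTwoRankZeroOffCaseOne` — supports only)

HONEST FRAMING (`run/shared/lean/pub/bsd-eis/README.md` §4): THEOREMS ONLY; nothing is booked. A per-pair
display feeds `ClassX3Gord.bsdp_three_degenerate_display_layerT_of_record` with: the 11 PUBLISHED
records, ONE Cremona datum `hL : L(W,1) = q·Ω_W` (`q ≠ 0`), ONE Q6 record
`hrec : CensusQ6.GordOddFirstUnitIndexAt W 3 n` (instrument), and KERNEL data — class predicate, `Σ₀`,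
good reduction, the `3`-torsion point, `T`, the U-side unit tables of gen 7 (`P, D, D2, D3, Tc, P01, nm`,
cubic-residue certificate `q, r, w, ω, e, L`), and the T-side tables: for each layer class `j < kT` the
sextuples `b, b', cb, t, t2, e3 ∈ ℤ⁶` and `E ∈ ℤ³` with the `decide`-able identities of
`KummerLayerTwisted.exists_layerTClass_of_tables` (`b·b' = (nT,0,…,0)`, `cb = c(b)`, `t = E(θ)`,
`t2 = t²`, `e3 = t2·t`, `cb·b = e3` in `ℤ[ζ₉]`), `nT_j ∣ N₀^64`, no `ℓ ∈ T` dividing an `nT_j`, and the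
cubic-residue certificate in `ℤ[ζ₉]` at primes `q' ≡ 1 (mod 27)` (`r'` the six roots of `X⁶+X³+1`,
Vandermonde inverse `w'`, `ω'`, exponents `e'`, left inverse `L'`); `n + Σδ + 1 ≤ #T + kT + k`.
* `sum6_eq` — `Σ_{i<6} bᵢ x^i` written out.
References: [GreenbergVatsal2000] §2 pp. 26–30; [MazurTateTeitelbaum1986Invent] §I.10, §I.13;
[Washington1997] §2, §13.1; [IrelandRosen1990] Ch. 9 §1.
-/

set_option autoImplicit false

noncomputable section

open scoped Classical AddSubgroup

namespace Summit.BirchSwinnertonDyer.Rank1Residual.Additive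

open WeierstrassCurve NumberField IsDedekindDomain Field
  Literature.NumberTheory.EllipticCurves
  Literature.NumberTheory.EllipticCurves.ModularForms
  Literature.NumberTheory.EllipticCurves.GreenbergSelmer
  Literature.NumberTheory.EllipticCurves.GreenbergVatsal2000
  Literature.NumberTheory.EllipticCurves.Rank1Residual
  Literature.NumberTheory.EllipticCurves.Rank1Residual.Typed
  Literature.NumberTheory.GaloisRepresentations
  Summit.BirchSwinnertonDyer.Rank1Residual.X1.MuLambda
  Summit.BirchSwinnertonDyer.Rank1Residual.AdditivePotMult
  Summit.BirchSwinnertonDyer.Rank1Residual.Additive.X3Branch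

namespace X3DegenerateDisplayKitLayerT

/-- **`Σ_{i<6} bᵢ x^i` written out.** [folklore] -/
theorem sum6_eq {A : Type*} [CommRing A] (x : A) (b : Fin 6 → ℤ) :
    (∑ k : Fin 6, (b k : A) * x ^ (k : ℕ)) =
      (b 0 : A) + b 1 * x + b 2 * x ^ 2 + b 3 * x ^ 3 + b 4 * x ^ 4 + b 5 * x ^ 5 := by
  rw [Fin.sum_univ_six]
  simp only [Fin.isValue, Fin.val_zero, Fin.val_one, Fin.val_two, pow_zero, mul_one, pow_one,
    show ((3 : Fin 6) : ℕ) = 3 from rfl, show ((4 : Fin 6) : ℕ) = 4 from rfl,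
    show ((5 : Fin 6) : ℕ) = 5 from rfl]

end X3DegenerateDisplayKitLayerT

open X3DegenerateDisplayKitLayerArith X3DegenerateDisplayKitLayerT KummerLayerTwisted in
/-- **`BSD₃(W)` on a DEGENERATE X3♯(G-ord) row of rank `0`, OFF the sub-locus, with T-SIDE LAYER CLASSES —
DISPLAY SHAPE in integer tables (NON-UNIT rows: ONE Q6 record `hrec`).** See the module docstring.
[cite: GreenbergVatsal2000, §2 pp. 26–30] [cite: MazurTateTeitelbaum1986Invent, §I.10 (10.1), §I.13]
[cite: Washington1997, §13.1] [cite: IrelandRosen1990, Ch. 9 §1] -/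
theorem _root_.Summit.BirchSwinnertonDyer.Rank1Residual.Additive.ClassX3Gord.bsdp_three_degenerate_display_layerT_of_record
    [Fact (Nat.Prime 3)] {W : WeierstrassCurve ℚ} [W.IsElliptic] [W.IsGloballyMinimal]
    (hTors : Greenberg1999.finite_torsion_cyclotomicZpExtension)
    (hDelG : Delbourgo1998.prop4_rankZero_constantCoeff_eq_unit_mul_of_potGoodOrd)
    (hDel98 : Delbourgo1998.prop4_rankZero_pow_dvd_constantCoeff)
    (hGZK : rank_eq_analyticRank_of_analyticRank_le_one) (hmod : hasEntireLFunction_rat)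
    (hmodD : nonempty_modularParametrizationData)
    (hW16 : Wuthrich2014.thm16_halfEigenCharIdeal_dvd_cyclotomicPrime)
    (h23 : datumSelmer_nonPrimitive_invariants)
    (hRQ : datumSelmer_divisible_of_finite_torsionBy_of_gr_inertiaInvariants_eq_zero)
    (hGrK : Greenberg1999.imKummer_ge_strictCondition_goodOrdinary)
    (hLiftE : residualEpsilon_surjOn_of_lineEven)
    (hX : ClassX3Gord W 3) {qL : ℚ} (hL : W.entireLFunction 1 = (qL : ℂ) * (W.realPeriodRat : ℂ))
    (hq0 : qL ≠ 0) {n : ℕ} (hrec : CensusQ6.GordOddFirstUnitIndexAt W 3 n)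
    (S₀ : Finset (HeightOneSpectrum (𝓞 ℚ))) (hne : S₀.Nonempty)
    (hS₀ : ∀ v ∈ S₀, ((3 : ℕ) : 𝓞 ℚ) ∉ v.asIdeal)
    (hS : ∀ v : HeightOneSpectrum (𝓞 ℚ), v ∉ S₀ → ((3 : ℕ) : 𝓞 ℚ) ∉ v.asIdeal →
      W.HasGoodReductionAt v)
    {x₀ y₀ : ℚ} (heq : y₀ ^ 2 + W.a₁ * x₀ * y₀ + W.a₃ * y₀ = x₀ ^ 3 + W.a₂ * x₀ ^ 2 + W.a₄ * x₀ + W.a₆)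
    (hψ : W.Ψ₃.eval x₀ = 0) (hd : W.Ψ₂Sq.eval x₀ ≠ 0)
    (T : Finset ℕ) (hT : ∀ ℓ ∈ T, ℓ.Prime ∧ 3 ∣ ℓ - 1 ∧ ∃ v ∈ S₀, ((ℓ : ℕ) : 𝓞 ℚ) ∈ v.asIdeal)
    -- U-side unit tables (as `…_display_layerArith_of_record`)
    {k : ℕ} (P : Fin k → Fin 3 → Fin 3 → ℤ)
    (hconj : ∀ i, P i 1 0 = P i 0 0 - 2 * P i 0 1 + 4 * P i 0 2 ∧ P i 1 1 = -P i 0 2 ∧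
      P i 1 2 = P i 0 1 - P i 0 2 ∧ P i 2 0 = P i 0 0 + 2 * P i 0 1 + 2 * P i 0 2 ∧
      P i 2 1 = -P i 0 1 + P i 0 2 ∧ P i 2 2 = -P i 0 1)
    (D D2 D3 Tc : Fin k → Fin 3 → Fin 3 → ℤ)
    (hD2 : ∀ i j, D2 i j 0 = D i j 0 * D i j 0 - (D i j 1 * D i j 2 + D i j 2 * D i j 1) ∧
      D2 i j 1 = D i j 0 * D i j 1 + D i j 1 * D i j 0 + 3 * (D i j 1 * D i j 2 + D i j 2 * D i j 1) -
        D i j 2 * D i j 2 ∧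
      D2 i j 2 = D i j 0 * D i j 2 + D i j 1 * D i j 1 + D i j 2 * D i j 0 + 3 * (D i j 2 * D i j 2))
    (hD3 : ∀ i j, D3 i j 0 = D2 i j 0 * D i j 0 - (D2 i j 1 * D i j 2 + D2 i j 2 * D i j 1) ∧
      D3 i j 1 = D2 i j 0 * D i j 1 + D2 i j 1 * D i j 0 + 3 * (D2 i j 1 * D i j 2 + D2 i j 2 * D i j 1) -
        D2 i j 2 * D i j 2 ∧
      D3 i j 2 = D2 i j 0 * D i j 2 + D2 i j 1 * D i j 1 + D2 i j 2 * D i j 0 + 3 * (D2 i j 2 * D i j 2))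
    (hPD3 : ∀ i j, 1 + 9 * Tc i j 0 = P i j 0 * D3 i j 0 - (P i j 1 * D3 i j 2 + P i j 2 * D3 i j 1) ∧
      9 * Tc i j 1 = P i j 0 * D3 i j 1 + P i j 1 * D3 i j 0 + 3 * (P i j 1 * D3 i j 2 + P i j 2 * D3 i j 1) -
        P i j 2 * D3 i j 2 ∧
      9 * Tc i j 2 = P i j 0 * D3 i j 2 + P i j 1 * D3 i j 1 + P i j 2 * D3 i j 0 + 3 * (P i j 2 * D3 i j 2))
    (P01 : Fin k → Fin 3 → ℤ) (nm : Fin k → ℕ) (hn0 : ∀ i, nm i ≠ 0)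
    (hP01 : ∀ i, P01 i 0 = P i 0 0 * P i 1 0 - (P i 0 1 * P i 1 2 + P i 0 2 * P i 1 1) ∧
      P01 i 1 = P i 0 0 * P i 1 1 + P i 0 1 * P i 1 0 + 3 * (P i 0 1 * P i 1 2 + P i 0 2 * P i 1 1) -
        P i 0 2 * P i 1 2 ∧
      P01 i 2 = P i 0 0 * P i 1 2 + P i 0 1 * P i 1 1 + P i 0 2 * P i 1 0 + 3 * (P i 0 2 * P i 1 2))
    (hN : ∀ i, (nm i : ℤ) = P01 i 0 * P i 2 0 - (P01 i 1 * P i 2 2 + P01 i 2 * P i 2 1) ∧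
      (0 : ℤ) = P01 i 0 * P i 2 1 + P01 i 1 * P i 2 0 + 3 * (P01 i 1 * P i 2 2 + P01 i 2 * P i 2 1) -
        P01 i 2 * P i 2 2 ∧
      (0 : ℤ) = P01 i 0 * P i 2 2 + P01 i 1 * P i 2 1 + P01 i 2 * P i 2 0 + 3 * (P01 i 2 * P i 2 2))
    (N₀ : ℕ) (hN₀ : ∀ v : HeightOneSpectrum (𝓞 ℚ), ((N₀ : ℕ) : 𝓞 ℚ) ∈ v.asIdeal → v ∈ S₀)
    (hnm : ∀ i, nm i ∣ N₀ ^ 64)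
    {ζ : AlgebraicClosure ℚ} (hζ : IsPrimitiveRoot ζ 9)
    {R : ℕ} (q : Fin R → ℕ) (hq : ∀ ρ, (q ρ).Prime) (hq1 : ∀ ρ, 3 ∣ q ρ - 1)
    (r : (ρ : Fin R) → Fin 3 → ZMod (q ρ)) (hrr : ∀ ρ kk, r ρ kk ^ 3 - 3 * r ρ kk + 1 = 0)
    (w : (ρ : Fin R) → Fin 3 → Fin 3 → ZMod (q ρ))
    (hw : ∀ ρ (c c' : Fin 3), ∑ kk, w ρ c kk * r ρ kk ^ c'.val = if c = c' then 1 else 0)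
    (ω : (ρ : Fin R) → ZMod (q ρ)) (hω : ∀ ρ, ω ρ ^ 3 = 1 ∧ ω ρ ≠ 1)
    (e : Fin R → Fin k → ℕ)
    (he : ∀ ρ i, ((P i 0 0 : ZMod (q ρ)) + (P i 0 1 : ZMod (q ρ)) * r ρ 0 +
      (P i 0 2 : ZMod (q ρ)) * r ρ 0 ^ 2) ^ ((q ρ - 1) / 3) = ω ρ ^ e ρ i)
    (hnz : ∀ ρ i, (P i 0 0 : ZMod (q ρ)) + (P i 0 1 : ZMod (q ρ)) * r ρ 0 +
      (P i 0 2 : ZMod (q ρ)) * r ρ 0 ^ 2 ≠ 0)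
    (Linv : Fin k → Fin R → ℤ)
    (hLinv : ∀ i i', (∑ ρ, (Linv i ρ : ZMod 3) * (e ρ i' : ZMod 3)) = if i = i' then 1 else 0)
    -- T-side layer-class tables (as `KummerLayerTwisted.exists_layerTClass_of_tables`)
    {kT : ℕ} (b b' cb t t2 e3 : Fin kT → Fin 6 → ℤ) (E : Fin kT → Fin 3 → ℤ) (nT : Fin kT → ℕ)
    (hnT0 : ∀ j, nT j ≠ 0)
    (hNT : ∀ j, (nT j : ℤ) = b j 0 * b' j 0 - (b j 1 * b' j 5 + b j 2 * b' j 4 + b j 3 * b' j 3 +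
        b j 4 * b' j 2 + b j 5 * b' j 1) + (b j 4 * b' j 5 + b j 5 * b' j 4) ∧
      (0 : ℤ) = b j 0 * b' j 1 + b j 1 * b' j 0 - (b j 2 * b' j 5 + b j 3 * b' j 4 + b j 4 * b' j 3 +
        b j 5 * b' j 2) + b j 5 * b' j 5 ∧
      (0 : ℤ) = b j 0 * b' j 2 + b j 1 * b' j 1 + b j 2 * b' j 0 - (b j 3 * b' j 5 + b j 4 * b' j 4 +
        b j 5 * b' j 3) ∧
      (0 : ℤ) = b j 0 * b' j 3 + b j 1 * b' j 2 + b j 2 * b' j 1 + b j 3 * b' j 0 -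
        (b j 1 * b' j 5 + b j 2 * b' j 4 + b j 3 * b' j 3 + b j 4 * b' j 2 + b j 5 * b' j 1) ∧
      (0 : ℤ) = b j 0 * b' j 4 + b j 1 * b' j 3 + b j 2 * b' j 2 + b j 3 * b' j 1 + b j 4 * b' j 0 -
        (b j 2 * b' j 5 + b j 3 * b' j 4 + b j 4 * b' j 3 + b j 5 * b' j 2) ∧
      (0 : ℤ) = b j 0 * b' j 5 + b j 1 * b' j 4 + b j 2 * b' j 3 + b j 3 * b' j 2 + b j 4 * b' j 1 +
        b j 5 * b' j 0 - (b j 3 * b' j 5 + b j 4 * b' j 4 + b j 5 * b' j 3))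
    (hcb : ∀ j, cb j 0 = b j 0 - b j 3 ∧ cb j 1 = -b j 2 ∧ cb j 2 = -b j 1 ∧ cb j 3 = -b j 3 ∧
      cb j 4 = b j 5 - b j 2 ∧ cb j 5 = b j 4 - b j 1)
    (ht : ∀ j, t j 0 = E j 0 + 2 * E j 2 ∧ t j 1 = E j 1 - E j 2 ∧ t j 2 = E j 2 - E j 1 ∧ t j 3 = 0 ∧
      t j 4 = -E j 2 ∧ t j 5 = -E j 1)
    (ht2 : ∀ j, t2 j 0 = t j 0 * t j 0 - (t j 1 * t j 5 + t j 2 * t j 4 + t j 3 * t j 3 + t j 4 * t j 2 +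
        t j 5 * t j 1) + (t j 4 * t j 5 + t j 5 * t j 4) ∧
      t2 j 1 = t j 0 * t j 1 + t j 1 * t j 0 - (t j 2 * t j 5 + t j 3 * t j 4 + t j 4 * t j 3 +
        t j 5 * t j 2) + t j 5 * t j 5 ∧
      t2 j 2 = t j 0 * t j 2 + t j 1 * t j 1 + t j 2 * t j 0 - (t j 3 * t j 5 + t j 4 * t j 4 +
        t j 5 * t j 3) ∧
      t2 j 3 = t j 0 * t j 3 + t j 1 * t j 2 + t j 2 * t j 1 + t j 3 * t j 0 -
        (t j 1 * t j 5 + t j 2 * t j 4 + t j 3 * t j 3 + t j 4 * t j 2 + t j 5 * t j 1) ∧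
      t2 j 4 = t j 0 * t j 4 + t j 1 * t j 3 + t j 2 * t j 2 + t j 3 * t j 1 + t j 4 * t j 0 -
        (t j 2 * t j 5 + t j 3 * t j 4 + t j 4 * t j 3 + t j 5 * t j 2) ∧
      t2 j 5 = t j 0 * t j 5 + t j 1 * t j 4 + t j 2 * t j 3 + t j 3 * t j 2 + t j 4 * t j 1 +
        t j 5 * t j 0 - (t j 3 * t j 5 + t j 4 * t j 4 + t j 5 * t j 3))
    (he3 : ∀ j, e3 j 0 = t2 j 0 * t j 0 - (t2 j 1 * t j 5 + t2 j 2 * t j 4 + t2 j 3 * t j 3 +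
        t2 j 4 * t j 2 + t2 j 5 * t j 1) + (t2 j 4 * t j 5 + t2 j 5 * t j 4) ∧
      e3 j 1 = t2 j 0 * t j 1 + t2 j 1 * t j 0 - (t2 j 2 * t j 5 + t2 j 3 * t j 4 + t2 j 4 * t j 3 +
        t2 j 5 * t j 2) + t2 j 5 * t j 5 ∧
      e3 j 2 = t2 j 0 * t j 2 + t2 j 1 * t j 1 + t2 j 2 * t j 0 - (t2 j 3 * t j 5 + t2 j 4 * t j 4 +
        t2 j 5 * t j 3) ∧
      e3 j 3 = t2 j 0 * t j 3 + t2 j 1 * t j 2 + t2 j 2 * t j 1 + t2 j 3 * t j 0 -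
        (t2 j 1 * t j 5 + t2 j 2 * t j 4 + t2 j 3 * t j 3 + t2 j 4 * t j 2 + t2 j 5 * t j 1) ∧
      e3 j 4 = t2 j 0 * t j 4 + t2 j 1 * t j 3 + t2 j 2 * t j 2 + t2 j 3 * t j 1 + t2 j 4 * t j 0 -
        (t2 j 2 * t j 5 + t2 j 3 * t j 4 + t2 j 4 * t j 3 + t2 j 5 * t j 2) ∧
      e3 j 5 = t2 j 0 * t j 5 + t2 j 1 * t j 4 + t2 j 2 * t j 3 + t2 j 3 * t j 2 + t2 j 4 * t j 1 +
        t2 j 5 * t j 0 - (t2 j 3 * t j 5 + t2 j 4 * t j 4 + t2 j 5 * t j 3))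
    (hflip : ∀ j, e3 j 0 = cb j 0 * b j 0 - (cb j 1 * b j 5 + cb j 2 * b j 4 + cb j 3 * b j 3 +
        cb j 4 * b j 2 + cb j 5 * b j 1) + (cb j 4 * b j 5 + cb j 5 * b j 4) ∧
      e3 j 1 = cb j 0 * b j 1 + cb j 1 * b j 0 - (cb j 2 * b j 5 + cb j 3 * b j 4 + cb j 4 * b j 3 +
        cb j 5 * b j 2) + cb j 5 * b j 5 ∧
      e3 j 2 = cb j 0 * b j 2 + cb j 1 * b j 1 + cb j 2 * b j 0 - (cb j 3 * b j 5 + cb j 4 * b j 4 +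
        cb j 5 * b j 3) ∧
      e3 j 3 = cb j 0 * b j 3 + cb j 1 * b j 2 + cb j 2 * b j 1 + cb j 3 * b j 0 -
        (cb j 1 * b j 5 + cb j 2 * b j 4 + cb j 3 * b j 3 + cb j 4 * b j 2 + cb j 5 * b j 1) ∧
      e3 j 4 = cb j 0 * b j 4 + cb j 1 * b j 3 + cb j 2 * b j 2 + cb j 3 * b j 1 + cb j 4 * b j 0 -
        (cb j 2 * b j 5 + cb j 3 * b j 4 + cb j 4 * b j 3 + cb j 5 * b j 2) ∧
      e3 j 5 = cb j 0 * b j 5 + cb j 1 * b j 4 + cb j 2 * b j 3 + cb j 3 * b j 2 + cb j 4 * b j 1 +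
        cb j 5 * b j 0 - (cb j 3 * b j 5 + cb j 4 * b j 4 + cb j 5 * b j 3))
    (hnTd : ∀ j, nT j ∣ N₀ ^ 64) (hTn : ∀ ℓ ∈ T, ∀ j, ¬ ℓ ∣ nT j)
    {R' : ℕ} (q' : Fin R' → ℕ) (hq' : ∀ ρ, (q' ρ).Prime) (hq27 : ∀ ρ, 27 ∣ q' ρ - 1)
    (r' : (ρ : Fin R') → Fin 6 → ZMod (q' ρ)) (hr' : ∀ ρ kk, r' ρ kk ^ 6 + r' ρ kk ^ 3 + 1 = 0)
    (w' : (ρ : Fin R') → Fin 6 → Fin 6 → ZMod (q' ρ))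
    (hw' : ∀ ρ (a a' : Fin 6), ∑ kk, w' ρ a kk * r' ρ kk ^ a'.val = if a = a' then 1 else 0)
    (ω' : (ρ : Fin R') → ZMod (q' ρ)) (hω' : ∀ ρ, ω' ρ ^ 3 = 1 ∧ ω' ρ ≠ 1)
    (e' : Fin R' → Fin kT → ℕ)
    (he' : ∀ ρ j, ((b j 0 : ZMod (q' ρ)) + (b j 1 : ZMod (q' ρ)) * r' ρ 0 +
      (b j 2 : ZMod (q' ρ)) * r' ρ 0 ^ 2 + (b j 3 : ZMod (q' ρ)) * r' ρ 0 ^ 3 +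
      (b j 4 : ZMod (q' ρ)) * r' ρ 0 ^ 4 + (b j 5 : ZMod (q' ρ)) * r' ρ 0 ^ 5) ^ ((q' ρ - 1) / 3) =
      ω' ρ ^ e' ρ j)
    (hnz' : ∀ ρ j, (b j 0 : ZMod (q' ρ)) + (b j 1 : ZMod (q' ρ)) * r' ρ 0 +
      (b j 2 : ZMod (q' ρ)) * r' ρ 0 ^ 2 + (b j 3 : ZMod (q' ρ)) * r' ρ 0 ^ 3 +
      (b j 4 : ZMod (q' ρ)) * r' ρ 0 ^ 4 + (b j 5 : ZMod (q' ρ)) * r' ρ 0 ^ 5 ≠ 0)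
    (L' : Fin kT → Fin R' → ℤ)
    (hL' : ∀ j j', (∑ ρ, (L' j ρ : ZMod 3) * (e' ρ j' : ZMod 3)) = if j = j' then 1 else 0)
    (hcount : n + ∑ v ∈ S₀, delta W 3 v + 1 ≤ T.card + kT + k) :
    BSDp W 3 := by
  have hθ : (ζ + ζ ^ 8) ^ 3 = 3 * (ζ + ζ ^ 8) - 1 := by
    linear_combination Summit.BirchSwinnertonDyer.Rank1Residual.Iwasawa.CyclotomicLayerOne.theta_cubic hζ
  have hrel : ζ ^ 6 + ζ ^ 3 + 1 = 0 := zeta9_rel hζ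
  have h9 : ζ ^ 9 = 1 := hζ.pow_eq_one
  -- `r_an = 0` from the non-vanishing `L`-value
  have hr : W.analyticRank = 0 := by
    refine (analyticRank_eq_zero_iff_holds (hmod _)).mpr ?_
    rw [hL]
    exact mul_ne_zero (by exact_mod_cast hq0) (by exact_mod_cast (realPeriodRat_pos_holds (W := W)).ne')
  -- the trivial rational line of the `3`-torsion point
  obtain ⟨Φ₀, hΦ, htriv⟩ := X3DegenerateDisplayKit.exists_trivialLine_of_ratPoint heq hψ hd
  refine ClassX3Gord.bsdp_three_rankZero_degenerate_of_facts_of_torsionFact_of_layerClassesT hTors hDelG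
    hDel98 hGZK hmod hmodD hW16 h23 hRQ hGrK hLiftE hX hr S₀ hne hS₀ hS Φ₀ hΦ htriv
    (ClassX3Gord.unitCoeffCert_three_of_gordOddFirstUnitIndex hX hrec) T hT hζ P ?_ ?_ D Tc ?_ nm hn0
    ?_ ?_ q hq hq1 r hrr w hw ω hω e he hnz Linv hLinv b b' E nT hnT0 ?_ ?_ ?_ hTn q' hq' hq27 r' hr'
    w' hw' ω' hω' e' ?_ ?_ L' hL' ?_
  · -- first conjugates
    intro i
    obtain ⟨h0, h1, h2, -, -, -⟩ := hconj i
    exact ev_conj1 hθ (P i 0) _ _ _ h0 h1 h2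
  · -- second conjugates
    intro i
    obtain ⟨-, -, -, h0, h1, h2⟩ := hconj i
    exact ev_conj2 hθ (P i 0) _ _ _ h0 h1 h2
  · -- local cubes
    intro i j
    obtain ⟨a0, a1, a2⟩ := hD2 i j
    obtain ⟨b0, b1, b2⟩ := hD3 i j
    obtain ⟨c0, c1, c2⟩ := hPD3 i j
    have e2 := ev_mul hθ (D i j) (D i j) _ _ _ a0 a1 a2
    have e3 := ev_mul hθ (D2 i j) (D i j) _ _ _ b0 b1 b2
    have e4 := ev_mul hθ (P i j) (D3 i j) _ _ _ c0 c1 c2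
    rw [pow_three, ← mul_assoc ((D i j 0 : AlgebraicClosure ℚ) + _ + _), e2, e3, e4]
    push_cast
    ring
  · -- norms
    intro i
    obtain ⟨a0, a1, a2⟩ := hP01 i
    obtain ⟨b0, b1, b2⟩ := hN i
    have e1 := ev_mul hθ (P i 0) (P i 1) _ _ _ a0 a1 a2
    have e2 := ev_mul hθ (P01 i) (P i 2) _ _ _ b0 b1 b2
    rw [← mul_assoc, e1, e2]
    push_cast
    ring
  · -- support of the norms
    intro i v hv
    exact mem_of_natCast_mem_of_dvd_pow hN₀ (hnm i) v hv
  · -- `b·b' = nT`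
    intro j
    obtain ⟨n0, n1, n2, n3, n4, n5⟩ := hNT j
    rw [sum6_eq, sum6_eq, ev9_mul hrel (b j) (b' j) (nT j : ℤ) 0 0 0 0 0 n0 n1 n2 n3 n4 n5]
    push_cast; ring
  · -- support of `nT`
    intro j v hv
    exact mem_of_natCast_mem_of_dvd_pow hN₀ (hnTd j) v hv
  · -- `c(b)·b = E(θ)³`
    intro j
    obtain ⟨c0, c1, c2, c3, c4, c5⟩ := hcb j
    obtain ⟨t0, t1, t2', t3, t4, t5⟩ := ht j
    obtain ⟨s0, s1, s2, s3, s4, s5⟩ := ht2 j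
    obtain ⟨u0, u1, u2, u3, u4, u5⟩ := he3 j
    obtain ⟨f0, f1, f2, f3, f4, f5⟩ := hflip j
    have hcb' := ev9_pow_eight hrel h9 (b j) _ _ _ _ _ _ c0 c1 c2 c3 c4 c5
    have ht' : (E j 0 : AlgebraicClosure ℚ) + E j 1 * (ζ + ζ ^ 8) + E j 2 * (ζ + ζ ^ 8) ^ 2 =
        (t j 0 : AlgebraicClosure ℚ) + t j 1 * ζ + t j 2 * ζ ^ 2 + t j 3 * ζ ^ 3 + t j 4 * ζ ^ 4 +
          t j 5 * ζ ^ 5 := by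
      rw [ev9_theta hrel h9 (E j) _ _ _ _ _ t0 t1 t2' t4 t5, t3]
      push_cast; ring
    have ht2' := ev9_mul hrel (t j) (t j) _ _ _ _ _ _ s0 s1 s2 s3 s4 s5
    have he3' := ev9_mul hrel (t2 j) (t j) _ _ _ _ _ _ u0 u1 u2 u3 u4 u5
    have hflip' := ev9_mul hrel (cb j) (b j) _ _ _ _ _ _ f0 f1 f2 f3 f4 f5
    have hcube : ((t j 0 : AlgebraicClosure ℚ) + t j 1 * ζ + t j 2 * ζ ^ 2 + t j 3 * ζ ^ 3 +
        t j 4 * ζ ^ 4 + t j 5 * ζ ^ 5) ^ 3 = (e3 j 0 : AlgebraicClosure ℚ) + e3 j 1 * ζ +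
        e3 j 2 * ζ ^ 2 + e3 j 3 * ζ ^ 3 + e3 j 4 * ζ ^ 4 + e3 j 5 * ζ ^ 5 := by
      rw [← he3', ← ht2']; ring
    rw [sum6_eq, sum6_eq, hcb', hflip', ht', hcube]
  · -- cubic-residue exponents, written out
    intro ρ j
    rw [sum6_eq]; exact he' ρ j
  · intro ρ j
    rw [sum6_eq]; exact hnz' ρ j
  · rwa [Fintype.card_fin, Fintype.card_fin]

end Summit.BirchSwinnertonDyer.Rank1Residual.Additive

end
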